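import Literature.RepresentationTheory.BorelWallach2000.UpqCasimirTensor
import Literature.NumberTheory.Automorphic.GKModulesSchur
import HarnessLib

/-!
# FLOOR-0 P3b «ENGINE local packets», line `F0_EngineLocalPackets` — STUB T6e CLOSED: the Casimir operator of an irreducible
# admissible `(𝔤, K)`-module of `U(α, β)` is a scalar (Dixmier–Schur)

Cell hodgecm-mathlib (D-0151), FLOOR 0, crux item H413 = stmt-HodgeConjecture-24833; sub-line `Cruxes/H413/Lines/F0_EngineLocalPackets.lean`
(F0P3b-plan (g0), edition 1, sha16 808dda7dd1cd10bb), registered stub `stub_T6e_casimirScalar : StubT6eCasimirScalar` (§2 there).  PROOF lane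
(theorems only); author A-p09 (g18).  Per the cell's stub-closer protocol (director s347) the Lines module is NOT imported: the theorem's TYPE is
the body of `…Cruxes.H413.F0EngineLocalPackets.StubT6eCasimirScalar` BINDER FOR BINDER, and the by-name fold
`theorem stub_T6e_casimirScalar : StubT6eCasimirScalar := F0P3bStubT6eCasimirScalar.stubT6e_holds` goes into the line at its next edition
(kernel certificate of the token identity: HOME `A-provers/A-p09/g18/CERT-T6e-token-identity.A-p09g18.lean`).

Content: for a `(𝔤, K)`-module `(ρK, ρ𝔤)` of `U(α, β) = uFormGroup α β` (`IsGKModule`) which is irreducible (`IsIrreducibleGK`) and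
admissible (`IsAdmissibleGK`), the Casimir operator `C_V = upqCasimirOp ρ𝔤` acts by a scalar: `∃ c, ∀ v, C_V v = c • v`.  Proof = Schur's
lemma for irreducible admissible `(𝔤, K)`-modules (★ `GKModulesSchur.exists_eq_algebraMap_of_comm`: an operator commuting with `ρK(K)`
and `ρ𝔤(𝔤)` is `algebraMap c`; [WallachRRG1, Lemma 3.3.2]) applied to `C_V`, which commutes with `𝔤` and `K`
(★ `upqCasimirOp_comm𝔤`, ★ `upqCasimirOp_commK`, [BorelWallach2000, II §1.3 (1)]).  This is [BorelWallach2000, II §3.1 ∕ Cor. 3.3]'s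
standing hypothesis «`σ(C) = s · Id`» made a theorem for every irreducible admissible `V`, and opens the tree's
★ `gkCohomology_casimir_dichotomy` (II 3.3) for such `V`.

HC_CM is proved only modulo the 7 printed citations until rung 0 closes; this closes ONE generic stub (T6e) of ONE floor-0 sub-line.

## References
* [BorelWallach2000] A. Borel, N. Wallach, 2nd ed., AMS 2000 — II §1.3 (1) (Casimir central), II §3.1, Cor. 3.3.
* [WallachRRG1] N. R. Wallach, *Real Reductive Groups I*, Academic Press 1988 — Lemma 3.3.2 (Schur for admissible `(𝔤,K)`-modules).
* [KnappVogan1995] A. Knapp, D. Vogan, *Cohomological Induction and Unitary Representations*, Princeton 1995 — Cor. 2.78, Prop. A.12.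
-/

-- Mathlib idiom (as in `GKModules`, `GKModulesSchur`, the `Upq*` files): commutator bracket on `Module.End`
attribute [local instance 100] LieRing.ofAssociativeRing

set_option autoImplicit false
set_option linter.dupNamespace false

noncomputable section

namespace Summit.HodgeConjecture.HodgeConjecture.Cruxes.H413.F0P3bStubT6eCasimirScalar

open Literature.NumberTheory.Automorphic
open Literature.RepresentationTheory.BorelWallach2000
open Literature.RepresentationTheory.KonnoKonno2007 Literature.RepresentationTheory.KonnoKonno2007.RealDualPair
open Literature.RepresentationTheory.KonnoKonno2007.RealDualPair.UForm

/-- **Dixmier–Schur for `U(α, β)`, element form**: on an irreducible admissible `(𝔤, K)`-module of `U(α, β)` the Casimir operator is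
`algebraMap ℂ (End V) c` for some `c` (★ Schur `exists_eq_algebraMap_of_comm` + ★ `upqCasimirOp_commK` ∕ `upqCasimirOp_comm𝔤`).
[cite: WallachRRG1, Lemma 3.3.2] [cite: BorelWallach2000, II §1.3 (1)] -/
theorem exists_upqCasimirOp_eq_algebraMap {α β : Type*} [Fintype α] [DecidableEq α] [Fintype β] [DecidableEq β]
    {V : Type*} [AddCommGroup V] [Module ℂ V]
    (ρK : Representation ℂ (uFormGroup α β).maximalCompact V) (ρ𝔤 : (uFormGroup α β).lie →ₗ⁅ℝ⁆ Module.End ℂ V)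
    (hV : IsGKModule (uFormGroup α β) ρK ρ𝔤) (hirr : IsIrreducibleGK ρK ρ𝔤) (hadm : IsAdmissibleGK ρK) :
    ∃ c : ℂ, upqCasimirOp ρ𝔤 = algebraMap ℂ (Module.End ℂ V) c :=
  exists_eq_algebraMap_of_comm hV hirr hadm (upqCasimirOp ρ𝔤)
    (fun k => (upqCasimirOp_commK ρK ρ𝔤 hV.ad_compat k).symm) (fun X => (upqCasimirOp_comm𝔤 ρ𝔤 X).symm)

/-- **STUB T6e of sub-line `F0_EngineLocalPackets`, proved** — the body of `StubT6eCasimirScalar` binder for binder: for every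
irreducible admissible `(𝔤, K)`-module of `U(α, β)` the Casimir operator acts by a scalar, `∃ c, ∀ v, upqCasimirOp ρ𝔤 v = c • v`.
[cite: BorelWallach2000, II §3.1, Cor. 3.3] [cite: WallachRRG1, Lemma 3.3.2] [cite: KnappVogan1995, Cor. 2.78] -/
theorem stubT6e_holds :
    ∀ (α β : Type) [Fintype α] [DecidableEq α] [Fintype β] [DecidableEq β]
    (V : Type) [AddCommGroup V] [Module ℂ V]
    (ρK : Representation ℂ (uFormGroup α β).maximalCompact V) (ρ𝔤 : (uFormGroup α β).lie →ₗ⁅ℝ⁆ Module.End ℂ V),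
    IsGKModule (uFormGroup α β) ρK ρ𝔤 → IsIrreducibleGK ρK ρ𝔤 → IsAdmissibleGK ρK →
    ∃ c : ℂ, ∀ v : V, upqCasimirOp ρ𝔤 v = c • v := by
  intro α β _ _ _ _ V _ _ ρK ρ𝔤 hV hirr hadm
  obtain ⟨c, hc⟩ := exists_upqCasimirOp_eq_algebraMap ρK ρ𝔤 hV hirr hadm
  exact ⟨c, fun v => by rw [hc, Module.algebraMap_end_apply]⟩

end Summit.HodgeConjecture.HodgeConjecture.Cruxes.H413.F0P3bStubT6eCasimirScalar

end
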